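import Summits.KontsevichZagierPeriods.KontsevichZagierPeriods.Theorems.RootDecompRelativeModAbsoluteCircleLogP5

/-! # `RootDecompRelativeModAbsoluteCircleLogP6` — part 6/11 of the mechanical ≤400-line split of `CircleLogTranscendence_landing.lean` (sha256 022159109aaffa3a…)
Source: decomp-kz lens-3 g13 `CircleLogTranscendence_v9.lean` (HOME/decomp-kz-lens-3/g13/, sha256 afb45a43…; critic g5-45/60/65/68/69 CLEARED FOR LANDING --supports 30572 (§4 defs, §8–§10 CircleLogStructureAt 0 from the tree's baker_decomposition_complex, constant-data cells every n, §16–§23 descent ingredients); landed by census-1 g9 over the landed CylLogSplitP52 (BLOCK G13): the duplicate def CircleLogStructure is dropped in favour of the landed one).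
Split by census-1 g9 `gen/splitlean.py`: scopes re-opened with their `open`/`variable`/`set_option` context; mathematics and declaration order unchanged. -/

noncomputable section
open Set MeasureTheory Filter Topology
open scoped BigOperators
open Literature.NumberTheory.Transcendental Literature.ModelTheory.ExponentialFields
namespace Summit.KontsevichZagierPeriods.RootDecompRelativeModAbsolute.Rung30571.RegularisedLogLayer.CylLog.Leaf
namespace G13

open scoped ContDiff in
/-- **`CircleLogStructureAt 1 ⟸ CircleLogStructureMoving` — PROVED** (constant-data interval cells are discharged by §9's
`circleLogStructure_constData`).  Partition: smooth locus of all `Wᵢ, uⱼ` (null complement) → interval cells of the tree's level-1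
CAD adapted to the zero sets of the partial derivatives `∂Wᵢ, ∂uⱼ` (which are `ℚ`-sa) → on each interval every derivative is `≡ 0`
or nowhere `0`; all `≡ 0` ⇒ constant data (convexity) ⇒ §9; otherwise the cell is MOVING ⇒ the residual; the two-level a.e.
partition is flattened. -/
theorem circleLogStructureAt_one_of_moving (hMov : CircleLogStructureMoving) : CircleLogStructureAt 1 := by
  classical
  intro k l U h W p u g hU hh hW hW0 hp hu hg hid
  -- smooth locus of the `W`, `u`
  obtain ⟨G₁, hG₁U, hG₁o, hG₁, hWsm, hn₁⟩ := exists_open_smooth_subset hU W hW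
  obtain ⟨G, hGG₁, hGo, hG, husm, hn₂⟩ :=
    exists_open_smooth_subset hG₁ u fun j => (hu j).mono hG₁U hG₁
  have hGU : G ⊆ U := hGG₁.trans hG₁U
  have hWsm' : ∀ i, ContDiffOn ℝ ∞ (W i) G := fun i => (hWsm i).mono hGG₁
  have hWd : ∀ i, ∀ x ∈ G, DifferentiableAt ℝ (W i) x := fun i x hx =>
    ((hWsm' i).differentiableOn (by simp)).differentiableAt (hGo.mem_nhds hx)
  have hud : ∀ j, ∀ x ∈ G, DifferentiableAt ℝ (u j) x := fun j x hx =>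
    ((husm j).differentiableOn (by simp)).differentiableAt (hGo.mem_nhds hx)
  -- the partial derivatives are `ℚ`-sa on `G`; their zero sets
  set dW : Fin k → (Fin 1 → ℝ) → ℝ := fun i x => fderiv ℝ (W i) x (Pi.single 0 1) with hdW_def
  set du : Fin l → (Fin 1 → ℝ) → ℝ := fun j x => fderiv ℝ (u j) x (Pi.single 0 1) with hdu_def
  have hdW : ∀ i, IsSemialgebraicFunOn ℚ G (dW i) := fun i =>
    IsSemialgebraicFunOn.fderiv_apply_single hGo ((hW i).mono hGU hG) (hWd i) 0
  have hdu : ∀ j, IsSemialgebraicFunOn ℚ G (du j) := fun j =>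
    IsSemialgebraicFunOn.fderiv_apply_single hGo ((hu j).mono hGU hG) (hud j) 0
  set Z : Fin (k + l) → Set (Fin 1 → ℝ) :=
    Fin.append (fun i => {x | x ∈ G ∧ dW i x = 0}) (fun j => {x | x ∈ G ∧ du j x = 0}) with hZ_def
  have hZ : ∀ t, IsSemialgebraic ℚ (Z t) := by
    intro t
    induction t using Fin.addCases with
    | left i => simp only [hZ_def, Fin.append_left]; exact (hdW i).isSemialgebraic_sep_eq_zero
    | right j => simp only [hZ_def, Fin.append_right]; exact (hdu j).isSemialgebraic_sep_eq_zero
  obtain ⟨B, T, hT, hTd, hTn, hTZ⟩ := exists_interval_cells hG Z hZ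
  -- per interval cell
  have hcellCLS : ∀ b, ∃ (N : ℕ) (C : Fin N → Set (Fin 1 → ℝ)),
      (∀ c, IsSemialgebraic ℚ (C c) ∧ IsOpen (C c) ∧ C c ⊆ T b) ∧
      Pairwise (Function.onFun Disjoint C) ∧ volume (T b \ ⋃ c, C c) = 0 ∧
      ∀ c, (∀ x ∈ C c, g x = 0) ∧
        ∃ (R : ℕ) (f : Fin R → Fin k → ℤ) (q : Fin R → (Fin 1 → ℝ) → ℝ)
          (S : ℕ) (f' : Fin S → Fin l → ℤ) (m : Fin S → ℚ) (q' : Fin S → (Fin 1 → ℝ) → ℝ),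
          (∀ r, IsSemialgebraicFunOn ℚ (C c) (q r)) ∧ (∀ r, ∀ x ∈ C c, ∏ i, W i x ^ (f r i) = 1) ∧
          (∀ i, ∀ x ∈ C c, h i x = ∑ r, q r x * (f r i : ℝ)) ∧
          (∀ s, IsSemialgebraicFunOn ℚ (C c) (q' s)) ∧
          (∀ s, ∀ x ∈ C c, ∑ j, (f' s j : ℝ) * Real.arctan (u j x) = (m s : ℝ) * Real.pi) ∧
          (∀ x ∈ C c, ∑ s, q' s x * (m s : ℝ) = 0) ∧
          (∀ j, ∀ x ∈ C c, p j x = ∑ s, q' s x * (f' s j : ℝ)) := by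
    intro b
    obtain ⟨hTsa, hTo, hTc, hTG⟩ := hT b
    have hTU : T b ⊆ U := hTG.trans hGU
    have hWdich : ∀ i, (∀ x ∈ T b, dW i x = 0) ∨ (∀ x ∈ T b, dW i x ≠ 0) := by
      intro i
      rcases hTZ b (Fin.castAdd l i) with hsub | hdis
      · left
        intro x hx
        have h1 := hsub hx
        simp only [hZ_def, Fin.append_left] at h1
        exact h1.2
      · right
        intro x hx h0
        refine Set.disjoint_left.mp hdis hx ?_
        simp only [hZ_def, Fin.append_left]
        exact ⟨hTG hx, h0⟩
    have hudich : ∀ j, (∀ x ∈ T b, du j x = 0) ∨ (∀ x ∈ T b, du j x ≠ 0) := by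
      intro j
      rcases hTZ b (Fin.natAdd k j) with hsub | hdis
      · left
        intro x hx
        have h1 := hsub hx
        simp only [hZ_def, Fin.append_right] at h1
        exact h1.2
      · right
        intro x hx h0
        refine Set.disjoint_left.mp hdis hx ?_
        simp only [hZ_def, Fin.append_right]
        exact ⟨hTG hx, h0⟩
    have hh' : ∀ i, IsSemialgebraicFunOn ℚ (T b) (h i) := fun i => (hh i).mono hTU hTsa
    have hW' : ∀ i, IsSemialgebraicFunOn ℚ (T b) (W i) := fun i => (hW i).mono hTU hTsa
    have hW0' : ∀ i, ∀ x ∈ T b, 0 < W i x := fun i x hx => hW0 i x (hTU hx)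
    have hp' : ∀ j, IsSemialgebraicFunOn ℚ (T b) (p j) := fun j => (hp j).mono hTU hTsa
    have hu' : ∀ j, IsSemialgebraicFunOn ℚ (T b) (u j) := fun j => (hu j).mono hTU hTsa
    have hg' : IsSemialgebraicFunOn ℚ (T b) g := hg.mono hTU hTsa
    have hid' : ∀ x ∈ T b, ∑ i, h i x * Real.log (W i x) + ∑ j, p j x * Real.arctan (u j x) = g x :=
      fun x hx => hid x (hTU hx)
    by_cases hmov : (∃ i, ∀ x ∈ T b, dW i x ≠ 0) ∨ (∃ j, ∀ x ∈ T b, du j x ≠ 0)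
    · exact hMov k l (T b) h W p u g hTsa hTo hTc hh' hW' hW0' hp' hu' hg' (fun i => (hWsm' i).mono hTG)
        (fun j => (husm j).mono hTG) hWdich hudich hmov hid'
    · push Not at hmov
      obtain ⟨hmW, hmu⟩ := hmov
      have hWz : ∀ i, ∀ x ∈ T b, dW i x = 0 := fun i => (hWdich i).resolve_right fun hne => by
        obtain ⟨x, hx, h0⟩ := hmW i
        exact hne x hx h0
      have huz : ∀ j, ∀ x ∈ T b, du j x = 0 := fun j => (hudich j).resolve_right fun hne => by
        obtain ⟨x, hx, h0⟩ := hmu j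
        exact hne x hx h0
      have hWc : ∀ i, ∀ x ∈ T b, ∀ y ∈ T b, W i x = W i y := fun i =>
        eq_of_fderiv_single_eq_zero hTo hTc (((hWsm' i).mono hTG).differentiableOn (by simp)) (hWz i)
      have huc : ∀ j, ∀ x ∈ T b, ∀ y ∈ T b, u j x = u j y := fun j =>
        eq_of_fderiv_single_eq_zero hTo hTc (((husm j).mono hTG).differentiableOn (by simp)) (huz j)
      exact circleLogStructure_constData hTsa hTo hh' hW' hW0' hp' hu' hg' hWc huc hid'
  choose N C hC hCd hCn hdata using hcellCLS
  obtain ⟨M, E, hE, hEd, hEn⟩ := exists_flatten_partition T (fun b => (hT b).2.2.2) hTd hTn N C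
    (fun b c => (hC b c).2.2) hCd hCn
    (P := fun S => IsSemialgebraic ℚ S ∧ IsOpen S ∧ ((∀ x ∈ S, g x = 0) ∧
        ∃ (R : ℕ) (f : Fin R → Fin k → ℤ) (q : Fin R → (Fin 1 → ℝ) → ℝ)
          (S' : ℕ) (f' : Fin S' → Fin l → ℤ) (m : Fin S' → ℚ) (q' : Fin S' → (Fin 1 → ℝ) → ℝ),
          (∀ r, IsSemialgebraicFunOn ℚ S (q r)) ∧ (∀ r, ∀ x ∈ S, ∏ i, W i x ^ (f r i) = 1) ∧
          (∀ i, ∀ x ∈ S, h i x = ∑ r, q r x * (f r i : ℝ)) ∧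
          (∀ s, IsSemialgebraicFunOn ℚ S (q' s)) ∧
          (∀ s, ∀ x ∈ S, ∑ j, (f' s j : ℝ) * Real.arctan (u j x) = (m s : ℝ) * Real.pi) ∧
          (∀ x ∈ S, ∑ s, q' s x * (m s : ℝ) = 0) ∧
          (∀ j, ∀ x ∈ S, p j x = ∑ s, q' s x * (f' s j : ℝ))))
    (fun b c => ⟨(hC b c).1, (hC b c).2.1, hdata b c⟩)
  refine ⟨M, E, fun j => ⟨(hE j).2.1, (hE j).2.2.1, (hE j).1.trans hGU⟩, hEd, ?_, fun j => (hE j).2.2.2⟩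
  have hUG : volume (U \ G) = 0 :=
    measure_mono_null (fun x hx => by
      by_cases h1 : x ∈ G₁
      · exact Or.inr ⟨h1, hx.2⟩
      · exact Or.inl ⟨hx.1, h1⟩) (measure_union_null hn₁ hn₂)
  exact measure_mono_null (fun x hx => by
    by_cases hxG : x ∈ G
    · exact Or.inr ⟨hxG, hx.2⟩
    · exact Or.inl ⟨hx.1, hxG⟩) (measure_union_null hUG hEn)

/-! ### §12 THE LOG-LINEAR CELLS FALL TO THE TREE — `CircleLogStructureAt 1 ⟸ CircleLogStructureMovingCirc` (PROVED)

The tree PROVES the structure theorem for `ℚ`-semialgebraic LOG-linear identities in every base dimension (route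
`LiouvilleUnfolding`, crux `LogPrimitiveNL`, line `logderiv-peeling`: `stub_descent stub_peelingStep stub_constRigidity`, all landed;
composed here BY NAME as `logStructure`).  Hence `CircleLogStructureAt n` holds on every cell where the arctangent coefficients vanish
(`circleLogStructureAt_of_p_eq_zero`, every `n`), and the §10 reduction sharpens: refining the interval cells also by the zero sets of
the `pⱼ`, the residual is `CircleLogStructureMovingCirc` — an identity on an interval cell with a GENUINE arctangent term (some `pⱼ`
nowhere zero) AND a moving datum (`circleLogStructureAt_one_of_movingCirc`).  Node v3: §13. -/

/-- **The tree's structure theorem for `ℚ`-semialgebraic LOG-linear identities** (route `LiouvilleUnfolding`, crux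
`LogPrimitiveNL`, line `logderiv-peeling`: `stub_descent stub_peelingStep stub_constRigidity` — Kolchin–Ostrowski descent along the
base + Baker at algebraic points; all three landed, composed here BY NAME), every base dimension. -/
theorem logStructure (n k : ℕ) (U : Set (Fin n → ℝ)) (h W : Fin k → (Fin n → ℝ) → ℝ) (g : (Fin n → ℝ) → ℝ)
    (hU : IsSemialgebraic ℚ U) (hh : ∀ i, IsSemialgebraicFunOn ℚ U (h i)) (hW : ∀ i, IsSemialgebraicFunOn ℚ U (W i))
    (hW0 : ∀ i, ∀ x ∈ U, 0 < W i x) (hg : IsSemialgebraicFunOn ℚ U g)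
    (hid : ∀ x ∈ U, ∑ i, h i x * Real.log (W i x) = g x) :
    ∃ (N : ℕ) (C : Fin N → Set (Fin n → ℝ)),
      (∀ c, IsSemialgebraic ℚ (C c) ∧ IsOpen (C c) ∧ C c ⊆ U) ∧
      Pairwise (Function.onFun Disjoint C) ∧ volume (U \ ⋃ c, C c) = 0 ∧
      ∀ c, (∀ x ∈ C c, g x = 0) ∧
        ∃ (R : ℕ) (f : Fin R → Fin k → ℤ) (q : Fin R → (Fin n → ℝ) → ℝ),
          (∀ r, IsSemialgebraicFunOn ℚ (C c) (q r)) ∧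
          (∀ r, ∀ x ∈ C c, ∏ i, W i x ^ (f r i) = 1) ∧
          (∀ i, ∀ x ∈ C c, h i x = ∑ r, q r x * (f r i : ℝ)) :=
  Summit.KontsevichZagierPeriods.LiouvilleUnfolding.LogPrimitiveNL.stub_descent
    Summit.KontsevichZagierPeriods.LiouvilleUnfolding.LogPrimitiveNL.stub_peelingStep
    Summit.KontsevichZagierPeriods.LiouvilleUnfolding.LogPrimitiveNL.stub_constRigidity n k U h W g hU hh hW hW0 hg hid

/-- **`CircleLogStructureAt n` holds whenever the arctangent coefficients vanish** (in particular for `l = 0`): the identity is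
then LOG-linear and the tree's structure theorem `logStructure` applies; the angle part of the conclusion is empty (`S = 0`).
PROVED, every base dimension `n`. -/
theorem circleLogStructureAt_of_p_eq_zero (n k l : ℕ) (U : Set (Fin n → ℝ)) (h W : Fin k → (Fin n → ℝ) → ℝ)
    (p u : Fin l → (Fin n → ℝ) → ℝ) (g : (Fin n → ℝ) → ℝ)
    (hU : IsSemialgebraic ℚ U) (hh : ∀ i, IsSemialgebraicFunOn ℚ U (h i))
    (hW : ∀ i, IsSemialgebraicFunOn ℚ U (W i)) (hW0 : ∀ i, ∀ x ∈ U, 0 < W i x)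
    (hg : IsSemialgebraicFunOn ℚ U g) (hp0 : ∀ j, ∀ x ∈ U, p j x = 0)
    (hid : ∀ x ∈ U, ∑ i, h i x * Real.log (W i x) + ∑ j, p j x * Real.arctan (u j x) = g x) :
    ∃ (N : ℕ) (C : Fin N → Set (Fin n → ℝ)),
      (∀ c, IsSemialgebraic ℚ (C c) ∧ IsOpen (C c) ∧ C c ⊆ U) ∧
      Pairwise (Function.onFun Disjoint C) ∧ volume (U \ ⋃ c, C c) = 0 ∧
      ∀ c, (∀ x ∈ C c, g x = 0) ∧
        ∃ (R : ℕ) (f : Fin R → Fin k → ℤ) (q : Fin R → (Fin n → ℝ) → ℝ)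
          (S : ℕ) (f' : Fin S → Fin l → ℤ) (m : Fin S → ℚ) (q' : Fin S → (Fin n → ℝ) → ℝ),
          (∀ r, IsSemialgebraicFunOn ℚ (C c) (q r)) ∧ (∀ r, ∀ x ∈ C c, ∏ i, W i x ^ (f r i) = 1) ∧
          (∀ i, ∀ x ∈ C c, h i x = ∑ r, q r x * (f r i : ℝ)) ∧
          (∀ s, IsSemialgebraicFunOn ℚ (C c) (q' s)) ∧
          (∀ s, ∀ x ∈ C c, ∑ j, (f' s j : ℝ) * Real.arctan (u j x) = (m s : ℝ) * Real.pi) ∧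
          (∀ x ∈ C c, ∑ s, q' s x * (m s : ℝ) = 0) ∧
          (∀ j, ∀ x ∈ C c, p j x = ∑ s, q' s x * (f' s j : ℝ)) := by
  have hid' : ∀ x ∈ U, ∑ i, h i x * Real.log (W i x) = g x := by
    intro x hx
    have h0 : ∑ j, p j x * Real.arctan (u j x) = 0 :=
      Finset.sum_eq_zero fun j _ => by rw [hp0 j x hx, zero_mul]
    have := hid x hx
    rwa [h0, add_zero] at this
  obtain ⟨N, C, hC, hdisj, hnull, hcell⟩ := logStructure n k U h W g hU hh hW hW0 hg hid'
  refine ⟨N, C, hC, hdisj, hnull, fun c => ⟨(hcell c).1, ?_⟩⟩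
  obtain ⟨R, f, q, hq, hf, hhq⟩ := (hcell c).2
  refine ⟨R, f, q, 0, fun s => s.elim0, fun s => s.elim0, fun s => s.elim0, hq, hf, hhq, fun s => s.elim0,
    fun s => s.elim0, fun x _ => by simp, fun j x hx => ?_⟩
  rw [hp0 j x ((hC c).2.2 hx)]
  simp

open scoped ContDiff in
/-- **The GENUINELY CIRCULAR moving residual** — `CircleLogStructureMoving` with, in addition, every arctangent coefficient `pⱼ`
either `≡ 0` or nowhere `0` on the cell and AT LEAST ONE nowhere `0`: the identity involves an arctangent term with non-vanishing
coefficient AND a moving datum.  (The complementary cells — all `pⱼ ≡ 0` — are LOG-linear and fall to the tree's structure theorem,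
`circleLogStructureAt_of_p_eq_zero`.)  [WEAKER · THEOREM-TYPE (Ax 1971 over `ℂ(x)` for the unimodular units `(1+iuⱼ)/(1−iuⱼ)`
jointly with the `Wᵢ`, + §9) · ATTACKABLE-WITH-PLAN] -/
def CircleLogStructureMovingCirc : Prop :=
  ∀ (k l : ℕ) (U : Set (Fin 1 → ℝ)) (h W : Fin k → (Fin 1 → ℝ) → ℝ) (p u : Fin l → (Fin 1 → ℝ) → ℝ)
    (g : (Fin 1 → ℝ) → ℝ),
    IsSemialgebraic ℚ U → IsOpen U → Convex ℝ U → (∀ i, IsSemialgebraicFunOn ℚ U (h i)) →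
    (∀ i, IsSemialgebraicFunOn ℚ U (W i)) → (∀ i, ∀ x ∈ U, 0 < W i x) →
    (∀ j, IsSemialgebraicFunOn ℚ U (p j)) → (∀ j, IsSemialgebraicFunOn ℚ U (u j)) →
    IsSemialgebraicFunOn ℚ U g →
    (∀ i, ContDiffOn ℝ ∞ (W i) U) → (∀ j, ContDiffOn ℝ ∞ (u j) U) →
    (∀ i, (∀ x ∈ U, fderiv ℝ (W i) x (Pi.single 0 1) = 0) ∨ (∀ x ∈ U, fderiv ℝ (W i) x (Pi.single 0 1) ≠ 0)) →
    (∀ j, (∀ x ∈ U, fderiv ℝ (u j) x (Pi.single 0 1) = 0) ∨ (∀ x ∈ U, fderiv ℝ (u j) x (Pi.single 0 1) ≠ 0)) →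
    ((∃ i, ∀ x ∈ U, fderiv ℝ (W i) x (Pi.single 0 1) ≠ 0) ∨ (∃ j, ∀ x ∈ U, fderiv ℝ (u j) x (Pi.single 0 1) ≠ 0)) →
    (∀ j, (∀ x ∈ U, p j x = 0) ∨ (∀ x ∈ U, p j x ≠ 0)) → (∃ j, ∀ x ∈ U, p j x ≠ 0) →
    (∀ x ∈ U, ∑ i, h i x * Real.log (W i x) + ∑ j, p j x * Real.arctan (u j x) = g x) →
    ∃ (N : ℕ) (C : Fin N → Set (Fin 1 → ℝ)),
      (∀ c, IsSemialgebraic ℚ (C c) ∧ IsOpen (C c) ∧ C c ⊆ U) ∧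
      Pairwise (Function.onFun Disjoint C) ∧ volume (U \ ⋃ c, C c) = 0 ∧
      ∀ c, (∀ x ∈ C c, g x = 0) ∧
        ∃ (R : ℕ) (f : Fin R → Fin k → ℤ) (q : Fin R → (Fin 1 → ℝ) → ℝ)
          (S : ℕ) (f' : Fin S → Fin l → ℤ) (m : Fin S → ℚ) (q' : Fin S → (Fin 1 → ℝ) → ℝ),
          (∀ r, IsSemialgebraicFunOn ℚ (C c) (q r)) ∧ (∀ r, ∀ x ∈ C c, ∏ i, W i x ^ (f r i) = 1) ∧
          (∀ i, ∀ x ∈ C c, h i x = ∑ r, q r x * (f r i : ℝ)) ∧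
          (∀ s, IsSemialgebraicFunOn ℚ (C c) (q' s)) ∧
          (∀ s, ∀ x ∈ C c, ∑ j, (f' s j : ℝ) * Real.arctan (u j x) = (m s : ℝ) * Real.pi) ∧
          (∀ x ∈ C c, ∑ s, q' s x * (m s : ℝ) = 0) ∧
          (∀ j, ∀ x ∈ C c, p j x = ∑ s, q' s x * (f' s j : ℝ))

end G13
end Summit.KontsevichZagierPeriods.RootDecompRelativeModAbsolute.Rung30571.RegularisedLogLayer.CylLog.Leaf
end
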